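import Summits.HodgeConjecture.HodgeConjecture.Theorems.F0P3cStCharTSTorusCompactPart                 -- ★ `mem_unitsIntegers_iff` (`u ∈ 𝒪_vˣ ↔ ∀ w, |u_w| = 1`); brings ★ `conjLocal_apply_eq_of_smul_eq`, ★ `finite_residueField_adicCompletion`
import Literature.NumberTheory.Automorphic.Liu2021.LemD1AsPrintedIndexedNonVacuityRamifiedConverse    -- ★ `valued_galAdicCompletionMap_sub_lt_one_of_ramified` (`σ_w ≡ id mod 𝔭_w` at a ramified place)
import Mathlib.FieldTheory.Finite.Basic
import HarnessLib

/-!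
# R90 · S1 ∕ U4Keys leaf (U4f-χ₁-ram-one-d0B) — the WILD-RAMIFIED corner is VACUOUS: at a ramified dyadic place, `hdepth ∧ hB` force `χ₁ = 1` on the integral units
# [Keys1984 §7; Rogawski1990 §12.2; Serre, Corps locaux IV §1–§2]

Cell `hodgecm-mathlib`, SLAB R90-TF, section S1 «Ch. 12 local», crux H413 = `stmt-HodgeConjecture-24833` (lane `--supports … --as helper`), route
HCCMUnconditional; prover seat `hodgecm-mathlib-R90-C10-p05` (g0); socket of record S1#3′ `R90.S1.stub_R90_122_keysThmTwo_ramifiedCharOne` = K2E3 leaf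
(U4f-χ₁-ram-one) ⊇ U4Keys :155 `sig_K2E3KeysThmTwoContractingRamifiedCharOneDepthZeroNormTrivial` (depth 0, Branch B).  THEOREMS ONLY (no definition ∕ instance ∕ notation ∕
named fact ∕ `sorry`); ★-only imports.  Paper: `K2/R90-C10-p05/PAPER-Z3-DepthZeroRamified.R90-C10-p05-g0.md` §4.

WHAT.  `R = LocalRing L v = Π_{w′∣v} L_{w′}` at a NON-SPLIT place `v` (one `w ∣ v`, fixed by complex conjugation), `σ = conjLocal`, `χ₁ : Rˣ →* ℂˣ`.  The letters of :155:
`hdepth` — `χ₁ u = 1` whenever `|u_{w′} − 1| < 1` for all `w′` (conductor ≤ 1); `hB` — `χ₁(u·σu) = 1` whenever `|u_{w′}| = 1` for all `w′` (Branch B, `w₀ ∈ W_χ`);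
`hram` — `χ₁` is NOT trivial on the integral units `(Π_{w′} 𝒪_{w′})ˣ`.
**`chi_eq_one_of_mem_unitsIntegers_of_ramified_dyadic`**: if `E_w∕F_v` is RAMIFIED (`e(w∣v) ≠ 1`) and DYADIC at `w` (`|2|_w < 1`), then `hdepth ∧ hB` imply `χ₁ u = 1` for
every integral unit `u` — i.e. `¬hram`: the leaf :155 holds VACUOUSLY at such places (its conclusion follows by `absurd`).
PROOF.  (1) `χ₁(u)² = 1`: at a ramified place `σ_w ≡ id (mod 𝔭_w)` on `𝒪_w` (★ `valued_galAdicCompletionMap_sub_lt_one_of_ramified`), so `p := u⁻¹·σu` is a principal unit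
(`|p_w − 1| = |u_w|⁻¹·|σ_w u_w − u_w| < 1`), `χ₁ p = 1` (`hdepth`), and `u·σu = u·u·p` gives `χ₁(u)² = 1` (`hB`).  (2) `χ₁(u)^{q−1} = 1`, `q = #𝓀_w`: the residue of `u_w` is a
non-zero element of the finite field `𝓀_w`, so `ū^{q−1} = 1` (Mathlib `FiniteField.pow_card_sub_one_eq_one`), i.e. `u^{q−1}` is a principal unit, killed by `hdepth`.  (3) `|2|_w < 1`
makes `𝓀_w` of characteristic `2`, so `q` is even (Mathlib `FiniteField.even_card_of_char_two`), `q − 1` is odd, and `z² = 1 = z^{q−1}` force `z = χ₁(u) = 1`.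
(At ramified places with `q` ODD the same `hdepth ∧ hB ∧ hram` force `χ̄₁` = the quadratic character of `𝓀ˣ` and the leaf has genuine content — paper §0–§2: `det M ∝ (qX−1)(X−q)`.)
HONEST LABEL: HC_CM is proved only modulo the 7 printed citations (2 remaining named inputs: hLiu418 = `stmt-HodgeConjecture-24832`, h413 = `stmt-HodgeConjecture-24833`)
until rung 0 closes; count-neutral helper (it discharges the wild-ramified places of :155 once the tie cases on the place type).

## References
* [Keys1984] D. Keys, *Principal series representations of special unitary groups over local fields*, Compositio Math. 51 (1984), §7 Thm. (2) p. 126.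
* [Rogawski1990] J. D. Rogawski, *Automorphic Representations of Unitary Groups in Three Variables*, Ann. of Math. Stud. 123 (1990), §12.2 (1)–(2) p. 173.
* [Serre1979] J.-P. Serre, *Local Fields*, GTM 67 (1979), Ch. IV §1 Prop. 4, §2 (the inertia group acts trivially on the residue field; `U¹` and the residue units).
-/

set_option autoImplicit false
-- the mandated namespace has the single-problem summit's repeated segment (`HodgeConjecture.HodgeConjecture`)
set_option linter.dupNamespace false

noncomputable section

open NumberField IsDedekindDomain Valued
open Literature.NumberTheory.Automorphic Literature.NumberTheory.Automorphic.UnitaryGroup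
open Summit.HodgeConjecture.HodgeConjecture.Cruxes.H413

namespace Summit.HodgeConjecture.HodgeConjecture.R90.S1

variable (L : Type) [Field L] [NumberField L] [IsCMField L] (v : HeightOneSpectrum (𝓞 ↥(maximalRealSubfield L)))
  (w : PlacesOver L v) (hw : IsCMField.complexConj L • w.1 = w.1)

include hw in
/-- **At a RAMIFIED DYADIC place, `hdepth ∧ hB ⟹ χ₁ = 1` on the integral units** (so U4Keys :155 ∕ S1#3′ at depth zero, Branch B, is vacuous there: its `hram` is contradicted).
`he`: `e(w ∣ v) ≠ 1` (Mathlib `Ideal.ramificationIdx'`); `h2`: `|2|_w < 1`.  (1) `χ₁(u)² = 1` from `hB` and `σ_w ≡ id (mod 𝔭_w)` (★ Liu D1 `valued_galAdicCompletionMap_sub_lt_one_of_ramified`)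
via `hdepth` on the principal unit `u⁻¹·σu`; (2) `χ₁(u)^{q−1} = 1` (`ū^{q−1} = 1` in `𝓀_w`, `hdepth` on `u^{q−1}`); (3) `q` even (`char 𝓀_w = 2`) ⇒ `χ₁ u = 1`.
[cite: Serre1979, Ch. IV §1 Prop. 4, §2] [cite: Keys1984, §7 Thm. (2) p. 126] [cite: Rogawski1990, §12.2 p. 173] -/
theorem chi_eq_one_of_mem_unitsIntegers_of_ramified_dyadic
    (he : v.asIdeal.ramificationIdx' w.1.asIdeal ≠ 1) (h2 : Valued.v (2 : w.1.adicCompletion L) < 1)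
    (χ₁ : (LocalRing L v)ˣ →* ℂˣ)
    (hdepth : ∀ u : (LocalRing L v)ˣ, (∀ w' : PlacesOver L v, Valued.v (((u : LocalRing L v) w') - 1) < 1) → χ₁ u = 1)
    (hB : ∀ u : (LocalRing L v)ˣ, (∀ w' : PlacesOver L v, Valued.v ((u : LocalRing L v) w') = 1) →
      χ₁ (u * Units.map (conjLocal L (IsCMField.complexConj L) v : LocalRing L v →* LocalRing L v) u) = 1) :
    ∀ u ∈ (Submonoid.pi Set.univ (fun w' : PlacesOver L v => (w'.1.adicCompletionIntegers L).toSubring.toSubmonoid)).units, χ₁ u = 1 := by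
  classical
  haveI : Subsingleton (PlacesOver L v) :=
    PlacesOver.subsingleton_of_smul_eq (IsCMField.complexConj L) (IsCMField.complexConj_ne_one L) w hw
  haveI : Algebra.IsQuadraticExtension ↥(maximalRealSubfield L) L := IsCMField.isQuadraticExtension L
  intro u hu
  have hu1 : ∀ w' : PlacesOver L v, Valued.v ((u : LocalRing L v) w') = 1 := (F0P3cStCharTSTorusCompactPart.mem_unitsIntegers_iff L v u).1 hu
  have hu1' : ∀ w' : PlacesOver L v, Valued.v (((u⁻¹ : (LocalRing L v)ˣ) : LocalRing L v) w') = 1 :=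
    (F0P3cStCharTSTorusCompactPart.mem_unitsIntegers_iff L v u⁻¹).1 (Subgroup.inv_mem _ hu)
  -- (1) `χ₁(u)² = 1`
  set p : (LocalRing L v)ˣ := u⁻¹ * Units.map (conjLocal L (IsCMField.complexConj L) v : LocalRing L v →* LocalRing L v) u with hpdef
  have hp : ∀ w' : PlacesOver L v, Valued.v (((p : LocalRing L v) w') - 1) < 1 := by
    intro w'
    obtain rfl : w' = w := Subsingleton.elim _ _
    have hinv : ((u⁻¹ : (LocalRing L v)ˣ) : LocalRing L v) w' * (u : LocalRing L v) w' = 1 := by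
      have e := congrArg (fun x : LocalRing L v => x w') u.inv_mul
      simpa only [Pi.mul_apply, Pi.one_apply] using e
    have hpw : (p : LocalRing L v) w' - 1 =
        ((u⁻¹ : (LocalRing L v)ˣ) : LocalRing L v) w' *
          (galAdicCompletionMap (L := L) (IsCMField.complexConj L) hw ((u : LocalRing L v) w') - (u : LocalRing L v) w') := by
      rw [hpdef, Units.val_mul, Units.coe_map, MonoidHom.coe_coe, Pi.mul_apply,
        conjLocal_apply_eq_of_smul_eq (IsCMField.complexConj L) (IsCMField.complexConj_ne_one L) v w' hw, mul_sub, hinv]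
    rw [hpw, map_mul, hu1' w', one_mul]
    exact Liu2021.LemD1IndexedNonVacuityRamifiedConverse.valued_galAdicCompletionMap_sub_lt_one_of_ramified L (IsCMField.complexConj L) v
      (IsCMField.complexConj_ne_one L) w' hw he _ (le_of_eq (hu1 w'))
  have hsq : χ₁ u * χ₁ u = 1 := by
    have e := hB u hu1
    rw [show u * Units.map (conjLocal L (IsCMField.complexConj L) v : LocalRing L v →* LocalRing L v) u = u * u * p by
      rw [hpdef, mul_assoc, mul_inv_cancel_left], map_mul, map_mul, hdepth p hp, mul_one] at e
    exact e
  -- (2) `χ₁(u)^(q−1) = 1`, `q = #𝓀_w`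
  haveI : Finite 𝓀[w.1.adicCompletion L] := finite_residueField_adicCompletion L w.1
  letI : Fintype 𝓀[w.1.adicCompletion L] := Fintype.ofFinite _
  set q : ℕ := Fintype.card 𝓀[w.1.adicCompletion L] with hqdef
  have hunit : ∀ x : 𝒪[w.1.adicCompletion L], IsUnit x ↔ Valued.v (x : w.1.adicCompletion L) = 1 :=
    fun x => (Valuation.integer.integers (Valued.v (R := w.1.adicCompletion L))).isUnit_iff_valuation_eq_one
  have hres0 : ∀ x : 𝒪[w.1.adicCompletion L], IsLocalRing.residue 𝒪[w.1.adicCompletion L] x = 0 ↔ Valued.v (x : w.1.adicCompletion L) < 1 := by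
    intro x
    rw [IsLocalRing.residue_eq_zero_iff, IsLocalRing.mem_maximalIdeal, mem_nonunits_iff, hunit]
    exact ⟨fun h => lt_of_le_of_ne x.2 h, fun h => ne_of_lt h⟩
  have hpow : ∀ w' : PlacesOver L v, Valued.v ((((u ^ (q - 1) : (LocalRing L v)ˣ)) : LocalRing L v) w' - 1) < 1 := by
    intro w'
    obtain rfl : w' = w := Subsingleton.elim _ _
    set x : 𝒪[w'.1.adicCompletion L] := ⟨(u : LocalRing L v) w', le_of_eq (hu1 w')⟩ with hxdef
    have hx0 : IsLocalRing.residue 𝒪[w'.1.adicCompletion L] x ≠ 0 := fun h0 => by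
      have h1 := (hres0 x).1 h0
      rw [hxdef] at h1
      exact (ne_of_lt h1) (hu1 w')
    have hq1 : IsLocalRing.residue 𝒪[w'.1.adicCompletion L] (x ^ (q - 1) - 1) = 0 := by
      rw [map_sub, map_pow, map_one, FiniteField.pow_card_sub_one_eq_one _ hx0, sub_self]
    have h := (hres0 _).1 hq1
    have hcoe : ((x ^ (q - 1) - 1 : 𝒪[w'.1.adicCompletion L]) : w'.1.adicCompletion L) = (u : LocalRing L v) w' ^ (q - 1) - 1 := by
      rw [hxdef]; push_cast; rfl
    rw [hcoe] at h
    rwa [Units.val_pow_eq_pow_val, Pi.pow_apply]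
  have hpq : χ₁ u ^ (q - 1) = 1 := by rw [← map_pow]; exact hdepth _ hpow
  -- (3) `q` is even (`|2|_w < 1` ⇒ `char 𝓀_w = 2`), so `χ₁ u = 1`
  have hchar : ringChar 𝓀[w.1.adicCompletion L] = 2 := by
    have h20 : (2 : 𝓀[w.1.adicCompletion L]) = 0 := by
      have h := (hres0 (2 : 𝒪[w.1.adicCompletion L])).2 h2
      rwa [map_ofNat] at h
    have hdvd : ringChar 𝓀[w.1.adicCompletion L] ∣ 2 := (ringChar.spec _ 2).1 (by exact_mod_cast h20)
    rcases (Nat.dvd_prime Nat.prime_two).1 hdvd with h1 | h1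
    · exact absurd h1 (CharP.ringChar_ne_one)
    · exact h1
  have heven : q % 2 = 0 := FiniteField.even_card_of_char_two hchar
  have hqpos : 0 < q := Fintype.card_pos
  obtain ⟨k, hk⟩ : ∃ k, q = 2 * k + 2 := ⟨q / 2 - 1, by omega⟩
  have hodd : q - 1 = 2 * k + 1 := by omega
  rw [hodd, pow_succ, pow_mul, pow_two, hsq, one_pow, one_mul] at hpq
  exact hpq

end Summit.HodgeConjecture.HodgeConjecture.R90.S1

end
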